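/-
Copyright: cell gate-hubbard-kl, typer seat t6 (D-0069 (2) B1 statement-typer wave). Proof file: discharges the named
fact `Lemma9ArchSystems` of `FermiRG/DR2000PartII.lean`; nothing here is a claim about the Hubbard model or about
superconductivity.
-/
import Mathlib
import Literature.MathematicalPhysics.QuantumLattice.FermiRG.DR2000PartII
import Literature.Analysis.OperatorTheory.KernelCyclicPeeling
import HarnessLib

/-!
# Disertori–Rivasseau 2000, Part II, App. B1 Lemma 9 — PROVED: arch systems do not develop a factorial

M. Disertori, V. Rivasseau, *Interacting Fermi liquid in two dimensions at finite temperature. Part II: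
Renormalization*, Commun. Math. Phys. **215** (2000) 291–341, arXiv:cond-mat/9907131 [DisertoriRivasseau2000b],
App. B1 Lemma 9 (B.8)–(B.10), render `paper:arxiv-cond-mat_9907131` p0016:L116–140 (LOCATOR = chunk:line of the
corpus-TeX render).  This file discharges the named fact
`Literature.MathematicalPhysics.QuantumLattice.FermiRG.DR2000.Lemma9ArchSystems` (cell FACT-LIST F-064, DAG row
DR2.L9) of the DEFINITION-FROZEN statement file `FermiRG/DR2000PartII.lean` WITHOUT touching that file:
`theorem Lemma9ArchSystems_holds : Lemma9ArchSystems`.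

THE PRINTED ARGUMENT (p0016:L128–137), followed line by line.  With `a₁ = m₁`,
`a_r(s₁,…,s_{r−1}) = m_r + s_{r−1} a_{r−1}(s₁,…,s_{r−2})` (typed 0-indexed as `archA m s`), the claim is
`∫₀¹ ∏ ds_r ∏_{r=1}^{q} a_r(s₁,…,s_{r−1}) ≤ e^{Σ_r m_r}`, «indeed obvious if we use inductively the fact that for
a > 0, b > 0, ∫₀¹ (as + b) ds ≤ (1/a) e^{a+b}».  We run the induction on the number `q` of factors, peeling the FIRST
interpolation parameter `s₀` (Fubini along `Fin.cons`, the tree's `integral_pi_succ_eq_integral_cons`): conditionally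
on `s₀ = t`, the remaining factors `a₁, a₂, …` form the arch sequence of the SHIFTED weights
`(m₁ + t m₀, m₂, m₃, …)` in the variables `(s₁, s₂, …)` (`archA_cons`), so the induction hypothesis gives
`∫ ∏_{r≥1} a_r ≤ e^{t m₀ + m₁ + ⋯ + m_{q}}`, and the last integral is the printed one-variable fact in its
division-free form `∫₀¹ m₀ e^{t m₀} dt = e^{m₀} − 1 ≤ e^{m₀}` (`integral_mul_exp_mul`).  Positivity `m_r ≥ 0`,
`s_r ∈ [0,1]` is what makes every factor nonnegative (the hypothesis of the typed fact).

TECHNICAL NOTE.  The Fubini lemma of the tree wants a globally bounded integrand, while `∏ a_r` is a polynomial in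
`s`; we therefore integrate the CLAMPED integrand `prodA` (coordinates projected onto `[0,1]` by `clamp`), which
coincides with the printed one on the cube `[0,1]^q` — the only place the measure
`volume.restrict [0,1]^q = ⨂ volume.restrict [0,1]` (Mathlib `Measure.restrict_pi_pi`) charges — and is bounded by
`∏_r (m₀ + ⋯ + m_r)` everywhere (`prodA_le`).  Helper names live in the sub-namespace `DR2000.ArchSystems`.
-/

noncomputable section

open MeasureTheory Set Real
open scoped BigOperators

namespace Literature.MathematicalPhysics.QuantumLattice.FermiRG.DR2000

namespace ArchSystems

open Literature.Analysis.OperatorTheory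

/-! ## Clamped coordinates and the integrand -/

/-- Projection of a real number onto `[0,1]`. [folklore] -/
def clamp (t : ℝ) : ℝ := max 0 (min 1 t)

/-- [folklore] -/
private theorem clamp_nonneg (t : ℝ) : 0 ≤ clamp t := le_max_left _ _

/-- [folklore] -/
private theorem clamp_le_one (t : ℝ) : clamp t ≤ 1 := max_le zero_le_one (min_le_left _ _)

/-- [folklore] -/
private theorem clamp_of_mem {t : ℝ} (h : t ∈ Icc (0 : ℝ) 1) : clamp t = t := by
  unfold clamp
  rw [min_eq_right h.2, max_eq_right h.1]

/-- [folklore] -/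
private theorem continuous_clamp : Continuous clamp :=
  continuous_const.max (continuous_const.min continuous_id)

/-- The clamped coordinate extension `ℕ → ℝ` of `s : Fin q → ℝ` (`0` beyond `q`). [folklore] -/
def extc {q : ℕ} (s : Fin q → ℝ) (j : ℕ) : ℝ := if h : j < q then clamp (s ⟨j, h⟩) else 0

/-- [folklore] -/
private theorem extc_nonneg {q : ℕ} (s : Fin q → ℝ) (j : ℕ) : 0 ≤ extc s j := by
  unfold extc
  split_ifs
  · exact clamp_nonneg _
  · exact le_rfl

/-- [folklore] -/
private theorem extc_le_one {q : ℕ} (s : Fin q → ℝ) (j : ℕ) : extc s j ≤ 1 := by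
  unfold extc
  split_ifs
  · exact clamp_le_one _
  · exact zero_le_one

/-- [folklore] -/
private theorem continuous_extc {q : ℕ} (j : ℕ) : Continuous fun s : Fin q → ℝ => extc s j := by
  unfold extc
  split_ifs with h
  · exact continuous_clamp.comp (continuous_apply _)
  · exact continuous_const

/-- Peeling the first coordinate: the `0`-th clamped coordinate of `y ∷ ζ'` is `clamp y`. [folklore] -/
private theorem extc_cons_zero {q : ℕ} (y : ℝ) (ζ' : Fin q → ℝ) :
    extc (Fin.cons y ζ' : Fin (q + 1) → ℝ) 0 = clamp y := by
  unfold extc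
  rw [dif_pos (Nat.succ_pos q)]
  rfl

/-- Peeling the first coordinate: the `(r+1)`-st clamped coordinate of `y ∷ ζ'` is the `r`-th of `ζ'`. [folklore] -/
private theorem extc_cons_succ {q : ℕ} (y : ℝ) (ζ' : Fin q → ℝ) (r : ℕ) :
    extc (Fin.cons y ζ' : Fin (q + 1) → ℝ) (r + 1) = extc ζ' r := by
  unfold extc
  by_cases h : r < q
  · rw [dif_pos (Nat.succ_lt_succ h), dif_pos h]
    have : (⟨r + 1, Nat.succ_lt_succ h⟩ : Fin (q + 1)) = (⟨r, h⟩ : Fin q).succ := rfl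
    rw [this, Fin.cons_succ]
  · rw [dif_neg (fun h' => h (Nat.lt_of_succ_lt_succ h')), dif_neg h]

/-- The arch sequence with all parameters in `[0,1]` and nonnegative weights is nonnegative and bounded by the
partial sums of the weights: `0 ≤ a_r ≤ m₀ + ⋯ + m_r`. [cite: DisertoriRivasseau2000b, App. B1 Lemma 9 (B.9) p0016:L131–134] -/
theorem archA_nonneg_le (m s : ℕ → ℝ) (hm : ∀ r, 0 ≤ m r) (hs0 : ∀ j, 0 ≤ s j) (hs1 : ∀ j, s j ≤ 1) (r : ℕ) :
    0 ≤ archA m s r ∧ archA m s r ≤ ∑ i ∈ Finset.range (r + 1), m i := by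
  induction r with
  | zero =>
    simp only [archA, zero_add, Finset.range_one, Finset.sum_singleton]
    exact ⟨hm 0, le_rfl⟩
  | succ r ih =>
    simp only [archA]
    refine ⟨add_nonneg (hm _) (mul_nonneg (hs0 r) ih.1), ?_⟩
    rw [Finset.sum_range_succ]
    have h1 : s r * archA m s r ≤ ∑ i ∈ Finset.range (r + 1), m i :=
      (mul_le_of_le_one_left ih.1 (hs1 r)).trans ih.2
    linarith

/-- Continuity of `s ↦ a_r(σ(s))` when every coordinate `s ↦ σ(s)_j` is continuous. [folklore] -/
private theorem continuous_archA {X : Type*} [TopologicalSpace X] (m : ℕ → ℝ) (σ : X → ℕ → ℝ)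
    (hσ : ∀ j, Continuous fun x => σ x j) (r : ℕ) : Continuous fun x => archA m (σ x) r := by
  induction r with
  | zero => simp only [archA]; exact continuous_const
  | succ r ih => simp only [archA]; exact continuous_const.add ((hσ r).mul ih)

/-- The (clamped) integrand `∏_{r<q} a_r`. [cite: DisertoriRivasseau2000b, App. B1 Lemma 9 (B.10) p0016:L135–137] -/
def prodA (q : ℕ) (m : ℕ → ℝ) (s : Fin q → ℝ) : ℝ := ∏ r ∈ Finset.range q, archA m (extc s) r

/-- The global bound `∏_{r<q} (m₀ + ⋯ + m_r)` of the clamped integrand. [folklore] -/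
def prodBound (q : ℕ) (m : ℕ → ℝ) : ℝ := ∏ r ∈ Finset.range q, ∑ i ∈ Finset.range (r + 1), m i

/-- [folklore] -/
private theorem prodA_nonneg (q : ℕ) (m : ℕ → ℝ) (hm : ∀ r, 0 ≤ m r) (s : Fin q → ℝ) : 0 ≤ prodA q m s :=
  Finset.prod_nonneg fun r _ => (archA_nonneg_le m (extc s) hm (extc_nonneg s) (extc_le_one s) r).1

/-- [folklore] -/
private theorem prodA_le (q : ℕ) (m : ℕ → ℝ) (hm : ∀ r, 0 ≤ m r) (s : Fin q → ℝ) : prodA q m s ≤ prodBound q m :=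
  Finset.prod_le_prod (fun r _ => (archA_nonneg_le m (extc s) hm (extc_nonneg s) (extc_le_one s) r).1)
    fun r _ => (archA_nonneg_le m (extc s) hm (extc_nonneg s) (extc_le_one s) r).2

/-- [folklore] -/
private theorem norm_prodA_le (q : ℕ) (m : ℕ → ℝ) (hm : ∀ r, 0 ≤ m r) (s : Fin q → ℝ) : ‖prodA q m s‖ ≤ prodBound q m := by
  rw [Real.norm_of_nonneg (prodA_nonneg q m hm s)]
  exact prodA_le q m hm s

/-- [folklore] -/
private theorem continuous_prodA (q : ℕ) (m : ℕ → ℝ) : Continuous (prodA q m) :=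
  continuous_finsetProd _ fun r _ => continuous_archA m extc continuous_extc r

/-! ## The shifted weights and the peeling identity -/

/-- The shifted weights `(m₁ + t m₀, m₂, m₃, …)`: conditionally on `s₀ = t`, the factors `a₁, a₂, …` are the arch
sequence of these weights in the variables `(s₁, s₂, …)` («we have m₂ choices to choose i₂ if it does not hook to
V₁. If it does hook to V₁, we have m₁ = a₁ choices, but we also have a factor s₁»).
[cite: DisertoriRivasseau2000b, App. B1 Lemma 9 p0016:L131–137] -/
def shift (m : ℕ → ℝ) (t : ℝ) : ℕ → ℝ
  | 0 => m 1 + t * m 0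
  | r + 1 => m (r + 2)

/-- [folklore] -/
private theorem shift_nonneg (m : ℕ → ℝ) (hm : ∀ r, 0 ≤ m r) {t : ℝ} (ht : 0 ≤ t) (r : ℕ) : 0 ≤ shift m t r := by
  cases r with
  | zero => exact add_nonneg (hm 1) (mul_nonneg ht (hm 0))
  | succ r => exact hm _

/-- `Σ_{r<q} shift(m,t)_r ≤ t m₀ + Σ_{r<q} m_{r+1}` (equality for `q ≥ 1`). [folklore] -/
private theorem sum_shift_le (m : ℕ → ℝ) (hm : ∀ r, 0 ≤ m r) {t : ℝ} (ht : 0 ≤ t) (q : ℕ) :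
    ∑ r ∈ Finset.range q, shift m t r ≤ t * m 0 + ∑ r ∈ Finset.range q, m (r + 1) := by
  cases q with
  | zero => simpa using mul_nonneg ht (hm 0)
  | succ q =>
    rw [Finset.sum_range_succ', Finset.sum_range_succ' (fun r => m (r + 1))]
    simp only [shift]
    linarith

/-- The peeling identity for the arch sequence: `a_{r+1}(y ∷ ζ') = a_r^{shift(m, clamp y)}(ζ')`.
[cite: DisertoriRivasseau2000b, App. B1 Lemma 9 (B.9) p0016:L131–137] -/
theorem archA_cons {q : ℕ} (m : ℕ → ℝ) (y : ℝ) (ζ' : Fin q → ℝ) (r : ℕ) :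
    archA m (extc (Fin.cons y ζ' : Fin (q + 1) → ℝ)) (r + 1) = archA (shift m (clamp y)) (extc ζ') r := by
  induction r with
  | zero =>
    simp only [archA, shift, extc_cons_zero]
  | succ r ih =>
    rw [archA, ih, extc_cons_succ]
    simp only [archA, shift]

/-- `∏_{r<q+1} a_r(y ∷ ζ') = m₀ · ∏_{r<q} a_r^{shift(m, clamp y)}(ζ')`. [folklore] -/
private theorem prodA_cons (q : ℕ) (m : ℕ → ℝ) (y : ℝ) (ζ' : Fin q → ℝ) :
    prodA (q + 1) m (Fin.cons y ζ') = m 0 * prodA q (shift m (clamp y)) ζ' := by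
  unfold prodA
  rw [Finset.prod_range_succ',
    Finset.prod_congr rfl fun r _ => archA_cons (q := q) m y ζ' r]
  simp only [archA]
  ring

/-! ## The one-variable fact and the induction -/

/-- The printed one-variable step in division-free form: `∫₀¹ m₀ e^{m₀ t} dt = e^{m₀} − 1`.
[cite: DisertoriRivasseau2000b, App. B1 Lemma 9 p0016:L137–138] -/
theorem integral_mul_exp_mul (a : ℝ) : ∫ t in Icc (0 : ℝ) 1, a * Real.exp (a * t) = Real.exp a - 1 := by
  rw [integral_Icc_eq_integral_Ioc, ← intervalIntegral.integral_of_le zero_le_one]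
  have hderiv : ∀ t ∈ uIcc (0 : ℝ) 1, HasDerivAt (fun t => Real.exp (a * t)) (a * Real.exp (a * t)) t := by
    intro t _
    have h := ((hasDerivAt_id t).const_mul a).exp
    simp only [id, mul_one] at h
    convert h using 1
    ring
  rw [intervalIntegral.integral_eq_sub_of_hasDerivAt hderiv
    ((continuous_const.mul (Real.continuous_exp.comp (continuous_const.mul continuous_id))).intervalIntegrable _ _)]
  simp

/-- **The induction** (on the number of factors, for the clamped integrand and the product of restricted Lebesgue
measures): `∫ ∏_{r<q} a_r d(volume|[0,1])^{⊗q} ≤ e^{Σ_{r<q} m_r}` for `m ≥ 0`.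
[cite: DisertoriRivasseau2000b, App. B1 Lemma 9 (B.10) p0016:L135–138] -/
theorem integral_prodA_le (q : ℕ) :
    ∀ m : ℕ → ℝ, (∀ r, 0 ≤ m r) →
      ∫ s, prodA q m s ∂(Measure.pi fun _ : Fin q => (volume : Measure ℝ).restrict (Icc (0 : ℝ) 1)) ≤
        Real.exp (∑ r ∈ Finset.range q, m r) := by
  induction q with
  | zero =>
    intro m hm
    have h1 : ∀ s : Fin 0 → ℝ, prodA 0 m s = 1 := fun s => by simp [prodA]
    simp only [h1, integral_const, smul_eq_mul, mul_one, Finset.range_zero, Finset.sum_empty, Real.exp_zero]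
    rw [measureReal_def, Measure.pi_univ]
    simp
  | succ q ih =>
    intro m hm
    set ρ : Measure ℝ := (volume : Measure ℝ).restrict (Icc (0 : ℝ) 1) with hρ
    rw [integral_pi_succ_eq_integral_cons (ρ := ρ) q (continuous_prodA (q + 1) m).measurable
      (norm_prodA_le (q + 1) m hm)]
    simp_rw [prodA_cons]
    -- the inner integrals are bounded by the induction hypothesis at the shifted weights
    set S' : ℝ := ∑ r ∈ Finset.range q, m (r + 1) with hS'
    have hbound : ∀ y : ℝ,
        ∫ ζ', m 0 * prodA q (shift m (clamp y)) ζ' ∂(Measure.pi fun _ : Fin q => ρ) ≤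
          m 0 * Real.exp (clamp y * m 0 + S') := fun y => by
      rw [integral_const_mul]
      refine mul_le_mul_of_nonneg_left ?_ (hm 0)
      refine (ih (shift m (clamp y)) (shift_nonneg m hm (clamp_nonneg y))).trans ?_
      exact Real.exp_le_exp.2 (sum_shift_le m hm (clamp_nonneg y) q)
    have hnonneg : ∀ y : ℝ, 0 ≤ ∫ ζ', m 0 * prodA q (shift m (clamp y)) ζ' ∂(Measure.pi fun _ : Fin q => ρ) :=
      fun y => integral_nonneg fun ζ' =>
        mul_nonneg (hm 0) (prodA_nonneg q _ (shift_nonneg m hm (clamp_nonneg y)) ζ')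
    have hg_cont : Continuous fun y : ℝ => m 0 * Real.exp (clamp y * m 0 + S') :=
      continuous_const.mul (Real.continuous_exp.comp ((continuous_clamp.mul continuous_const).add continuous_const))
    have hg_int : Integrable (fun y : ℝ => m 0 * Real.exp (clamp y * m 0 + S')) ρ :=
      hg_cont.integrableOn_Icc
    calc ∫ y, ∫ ζ', m 0 * prodA q (shift m (clamp y)) ζ' ∂(Measure.pi fun _ : Fin q => ρ) ∂ρ
        ≤ ∫ y, m 0 * Real.exp (clamp y * m 0 + S') ∂ρ :=
          integral_mono_of_nonneg (Filter.Eventually.of_forall hnonneg) hg_int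
            (Filter.Eventually.of_forall hbound)
      _ = ∫ y in Icc (0 : ℝ) 1, (m 0 * Real.exp (m 0 * y)) * Real.exp S' := by
          rw [hρ]
          refine setIntegral_congr_fun measurableSet_Icc fun y hy => ?_
          rw [clamp_of_mem hy, Real.exp_add, mul_comm y (m 0), mul_assoc]
      _ = (Real.exp (m 0) - 1) * Real.exp S' := by
          rw [integral_mul_const, integral_mul_exp_mul]
      _ ≤ Real.exp (∑ r ∈ Finset.range (q + 1), m r) := by
          rw [Finset.sum_range_succ', Real.exp_add, ← hS', mul_comm (Real.exp S')]
          have h1 : 0 < Real.exp S' := Real.exp_pos _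
          have h2 : Real.exp (m 0) - 1 ≤ Real.exp (m 0) := by linarith
          nlinarith

end ArchSystems

open ArchSystems in
/-- **DR 2000 Part II, App. B1 Lemma 9 — PROVED** (discharge of the named fact `Lemma9ArchSystems`, cell F-064):
for `q ≥ 1` and weights `m_r ≥ 0`, `∫_{[0,1]^q} ∏_{r<q} a_r(s) ds ≤ e^{Σ_{r<q} m_r}` with `a₀ = m₀`,
`a_{r+1} = m_{r+1} + s_r a_r` («the sum over all possible arch systems … does not develop a factorial»).  Proof =
the printed induction («use inductively the fact that … ∫₀¹ (as + b) ds ≤ (1/a)e^{a+b}»), run on the first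
interpolation parameter via the shifted weights, see the module docstring.
[cite: DisertoriRivasseau2000b, App. B1 Lemma 9 (B.8)–(B.10) p0016:L116–140] -/
theorem Lemma9ArchSystems_holds : Lemma9ArchSystems := by
  intro q m _hq hm
  have hmeas : MeasurableSet (Set.pi Set.univ fun _ : Fin q => Icc (0 : ℝ) 1) :=
    MeasurableSet.univ_pi fun _ => measurableSet_Icc
  -- on the cube the printed integrand is the clamped one
  have hcongr : ∫ s in Set.pi Set.univ (fun _ : Fin q => Icc (0 : ℝ) 1),
        ∏ r ∈ Finset.range q, archA m (fun j => if h : j < q then s ⟨j, h⟩ else 0) r =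
      ∫ s in Set.pi Set.univ (fun _ : Fin q => Icc (0 : ℝ) 1), prodA q m s := by
    refine setIntegral_congr_fun hmeas fun s hs => ?_
    have hext : (fun j => if h : j < q then s ⟨j, h⟩ else 0) = extc s := by
      funext j
      unfold extc
      split_ifs with h
      · exact (clamp_of_mem (Set.mem_univ_pi.1 hs ⟨j, h⟩)).symm
      · rfl
    simp only [prodA, hext]
  rw [hcongr, volume_pi, Measure.restrict_pi_pi]
  exact integral_prodA_le q m hm

end Literature.MathematicalPhysics.QuantumLattice.FermiRG.DR2000

end
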